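import Mathlib
import Literature.Analysis.FluidPDE.LambertCosineLaw

/-!
# Archimedes' angular reduction for radial × zonal integrands on `ℝ³`

Helper file of the stub `landauTail_integral_radial_mul_angular` (S4, "Archimedes' angular
reduction") of the crux `LandauTail.LandauTailBlowup` (stmt-NavierStokesRegularity-1944, line
registered): for a unit vector `a ∈ ℝ³`, `h` continuous and vanishing off an annulus
`r < s < R` (`0 < r`), and `g` continuous on `[-1, 1]`,

  `∫_{ℝ³} h(‖z‖) g(⟪a, z⟫ / ‖z‖) dz = 2π (∫₀^∞ h(s) s² ds) (∫_{-1}^{1} g(c) dc)`,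

i.e. `∫_{S²} g(⟪a, α⟫) dσ(α) = 2π ∫_{-1}^{1} g` (the hat-box theorem). Proof: Fubini through the
measure-preserving frame map `x ↦ (coords a x, ⟪a, x⟫) : ℝ³ → ℝ² × ℝ`
(`Literature.Analysis.FluidPDE.measurePreserving_coordsInner`), planar polar coordinates
(`MeasureTheory.integral_fun_norm_addHaar`), the substitution `s = √(ρ² + t²)` at fixed height `t`
(`MeasureTheory.integral_image_eq_integral_abs_deriv_smul`), a Fubini swap, and the substitution
`t = s c` at fixed radius `s`.
-/

set_option linter.dupNamespace false

namespace Summit.NavierStokesRegularity.NavierStokesRegularity.Theorems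

open MeasureTheory Set Filter
open scoped InnerProductSpace

/-- Planar polar coordinates for a radial integrand: `∫_{ℝ²} f(‖p‖) dp = 2π ∫₀^∞ y f(y) dy`
(no integrability hypothesis: both sides vanish together when undefined). [folklore] -/
theorem landauTail_integral_norm_fin_two (f : ℝ → ℝ) :
    ∫ p : EuclideanSpace ℝ (Fin 2), f ‖p‖ = 2 * Real.pi * ∫ y in Ioi (0 : ℝ), y * f y := by
  rw [integral_fun_norm_addHaar (volume : Measure (EuclideanSpace ℝ (Fin 2))) f,
    finrank_euclideanSpace_fin, Measure.real, EuclideanSpace.volume_ball_fin_two,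
    ENNReal.ofReal_one, one_pow, one_mul, ENNReal.toReal_ofReal Real.pi_pos.le, nsmul_eq_mul,
    smul_eq_mul]
  simp only [show 2 - 1 = 1 from rfl, pow_one, smul_eq_mul, Nat.cast_ofNat]
  ring

/-- For fixed `t`, the map `ρ ↦ √(ρ² + t²)` sends `(0, ∞)` onto `(|t|, ∞)`. [folklore] -/
theorem landauTail_image_sqrt_sq_add_sq (t : ℝ) :
    (fun ρ : ℝ => √(ρ ^ 2 + t ^ 2)) '' Ioi (0 : ℝ) = Ioi |t| := by
  ext s
  simp only [mem_image, mem_Ioi]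
  constructor
  · rintro ⟨ρ, hρ, rfl⟩
    calc |t| = √(t ^ 2) := (Real.sqrt_sq_eq_abs t).symm
      _ < √(ρ ^ 2 + t ^ 2) := Real.sqrt_lt_sqrt (sq_nonneg t) (by nlinarith)
  · intro hs
    have hs0 : 0 < s := (abs_nonneg t).trans_lt hs
    have hts : t ^ 2 < s ^ 2 := sq_lt_sq' (abs_lt.1 hs).1 (abs_lt.1 hs).2
    refine ⟨√(s ^ 2 - t ^ 2), Real.sqrt_pos.2 (by linarith), ?_⟩
    rw [Real.sq_sqrt (by linarith), sub_add_cancel, Real.sqrt_sq hs0.le]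

/-- The substitution `s = √(ρ² + t²)` (`ρ > 0`, `t` fixed, `ρ dρ = s ds`):
`∫_{|t|}^∞ G(s) ds = ∫₀^∞ (ρ / √(ρ² + t²)) G(√(ρ² + t²)) dρ`, with no integrability hypothesis
(change of variables along the injective map `ρ ↦ √(ρ² + t²)` of `(0, ∞)`). [folklore] -/
theorem landauTail_setIntegral_Ioi_abs_comp_sqrt (G : ℝ → ℝ) (t : ℝ) :
    ∫ s in Ioi |t|, G s = ∫ ρ in Ioi (0 : ℝ), ρ / √(ρ ^ 2 + t ^ 2) * G (√(ρ ^ 2 + t ^ 2)) := by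
  have hderiv : ∀ ρ ∈ Ioi (0 : ℝ), HasDerivWithinAt (fun ρ : ℝ => √(ρ ^ 2 + t ^ 2))
      (ρ / √(ρ ^ 2 + t ^ 2)) (Ioi 0) ρ := by
    intro ρ hρ
    have hρ0 : 0 < ρ := hρ
    have hpos : 0 < ρ ^ 2 + t ^ 2 := by positivity
    have hsq : HasDerivAt (fun x : ℝ => x ^ 2) (2 * ρ) ρ := by simpa using hasDerivAt_pow 2 ρ
    have h2 := (hsq.add_const (t ^ 2)).sqrt hpos.ne'
    refine (h2.congr_deriv ?_).hasDerivWithinAt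
    rw [mul_div_mul_left _ _ (two_ne_zero : (2 : ℝ) ≠ 0)]
  have hinj : InjOn (fun ρ : ℝ => √(ρ ^ 2 + t ^ 2)) (Ioi 0) := by
    refine StrictMonoOn.injOn fun x hx y hy hxy => ?_
    have hx0 : 0 < x := hx
    have hy0 : 0 < y := hy
    exact Real.sqrt_lt_sqrt (by positivity) (by nlinarith)
  have key := integral_image_eq_integral_abs_deriv_smul measurableSet_Ioi hderiv hinj G
  rw [landauTail_image_sqrt_sq_add_sq t] at key
  rw [key]
  refine setIntegral_congr_fun measurableSet_Ioi fun ρ hρ => ?_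
  have hρ0 : 0 < ρ := hρ
  simp only [smul_eq_mul, abs_of_nonneg (div_nonneg hρ0.le (Real.sqrt_nonneg _))]

/-- The `p`-integral of the frame-coordinate integrand at fixed height `t` (planar polar
coordinates, then `s = √(ρ² + t²)`):
`∫_{ℝ²} h(√(‖p‖² + t²)) g(t / √(‖p‖² + t²)) dp = 2π ∫_{|t|}^∞ s h(s) g(t / s) ds`. [folklore] -/
theorem landauTail_integral_slice_height (h g : ℝ → ℝ) (t : ℝ) :
    ∫ p : EuclideanSpace ℝ (Fin 2), h (√(‖p‖ ^ 2 + t ^ 2)) * g (t / √(‖p‖ ^ 2 + t ^ 2)) =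
      2 * Real.pi * ∫ s in Ioi |t|, s * h s * g (t / s) := by
  calc ∫ p : EuclideanSpace ℝ (Fin 2), h (√(‖p‖ ^ 2 + t ^ 2)) * g (t / √(‖p‖ ^ 2 + t ^ 2))
      = 2 * Real.pi * ∫ y in Ioi (0 : ℝ), y * (h (√(y ^ 2 + t ^ 2)) * g (t / √(y ^ 2 + t ^ 2))) :=
        landauTail_integral_norm_fin_two (fun y => h (√(y ^ 2 + t ^ 2)) * g (t / √(y ^ 2 + t ^ 2)))
    _ = 2 * Real.pi * ∫ ρ in Ioi (0 : ℝ), ρ / √(ρ ^ 2 + t ^ 2) *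
          (√(ρ ^ 2 + t ^ 2) * h (√(ρ ^ 2 + t ^ 2)) * g (t / √(ρ ^ 2 + t ^ 2))) := by
        congr 1
        refine setIntegral_congr_fun measurableSet_Ioi fun ρ hρ => ?_
        have hρ0 : 0 < ρ := hρ
        have hne : √(ρ ^ 2 + t ^ 2) ≠ 0 := (Real.sqrt_pos.2 (by positivity)).ne'
        field_simp
    _ = 2 * Real.pi * ∫ s in Ioi |t|, s * h s * g (t / s) := by
        rw [landauTail_setIntegral_Ioi_abs_comp_sqrt (fun s => s * h s * g (t / s)) t]

/-- The `t`-integral of the swapped kernel at fixed radius `s` (substitution `t = s c`):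
`∫ 1_{|t| < s} s h(s) g(t / s) dt = 1_{s > 0} h(s) s² ∫_{-1}^{1} g`. [folklore] -/
theorem landauTail_integral_slice_radius (h g : ℝ → ℝ) (s : ℝ) :
    ∫ t : ℝ, {q : ℝ × ℝ | |q.1| < q.2}.indicator (fun q => q.2 * h q.2 * g (q.1 / q.2)) (t, s) =
      (Ioi (0 : ℝ)).indicator (fun s => h s * s ^ 2 * ∫ c in (-1 : ℝ)..1, g c) s := by
  have hpt : ∀ t : ℝ,
      {q : ℝ × ℝ | |q.1| < q.2}.indicator (fun q => q.2 * h q.2 * g (q.1 / q.2)) (t, s) =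
        (Ioo (-s) s).indicator (fun t => s * h s * g (t / s)) t := by
    intro t
    by_cases ht : |t| < s
    · rw [indicator_of_mem (show (t, s) ∈ {q : ℝ × ℝ | |q.1| < q.2} from ht),
        indicator_of_mem (show t ∈ Ioo (-s) s from abs_lt.1 ht)]
    · rw [indicator_of_notMem (show (t, s) ∉ {q : ℝ × ℝ | |q.1| < q.2} from ht),
        indicator_of_notMem (show t ∉ Ioo (-s) s from fun h' => ht (abs_lt.2 h'))]
  simp_rw [hpt]
  rw [integral_indicator measurableSet_Ioo]
  rcases le_or_gt s 0 with hs | hs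
  · rw [indicator_of_notMem (show s ∉ Ioi (0 : ℝ) from not_lt.2 hs),
      Ioo_eq_empty_of_le (by linarith : s ≤ -s), Measure.restrict_empty, integral_zero_measure]
  · rw [indicator_of_mem (show s ∈ Ioi (0 : ℝ) from hs), integral_const_mul,
      ← integral_Ioc_eq_integral_Ioo, ← intervalIntegral.integral_of_le (by linarith : -s ≤ s),
      intervalIntegral.integral_comp_div g hs.ne', neg_div, div_self hs.ne', smul_eq_mul]
    ring

/-- The swapped kernel `(t, s) ↦ 1_{|t| < s} s h(s) g(t / s)` is integrable on `ℝ × ℝ` when `h`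
and `g` are continuous and bounded and `h` vanishes off `(r, R)` with `0 < r` (it is bounded,
measurable and supported in the closed ball of radius `R`). [folklore] -/
theorem landauTail_integrable_kernel (h g : ℝ → ℝ) (hh : Continuous h) (hg : Continuous g)
    {r R Ch Cg : ℝ} (hr : 0 < r) (hzero : ∀ s : ℝ, (s ≤ r ∨ R ≤ s) → h s = 0)
    (hCh : ∀ s, ‖h s‖ ≤ Ch) (hCg : ∀ c, ‖g c‖ ≤ Cg) :
    Integrable ({q : ℝ × ℝ | |q.1| < q.2}.indicator (fun q => q.2 * h q.2 * g (q.1 / q.2)))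
      ((volume : Measure ℝ).prod (volume : Measure ℝ)) := by
  set K := {q : ℝ × ℝ | |q.1| < q.2}.indicator (fun q => q.2 * h q.2 * g (q.1 / q.2)) with hK
  have hUm : MeasurableSet {q : ℝ × ℝ | |q.1| < q.2} :=
    measurableSet_lt (continuous_abs.measurable.comp measurable_fst) measurable_snd
  have hGm : Measurable fun q : ℝ × ℝ => q.2 * h q.2 * g (q.1 / q.2) :=
    (measurable_snd.mul (hh.measurable.comp measurable_snd)).mul
      (hg.measurable.comp (measurable_fst.div measurable_snd))
  have hKm : Measurable K := hGm.indicator hUm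
  have hCh0 : 0 ≤ Ch := (norm_nonneg _).trans (hCh 0)
  -- off `(r, R)` the factor `h` kills the kernel
  have hsR : ∀ s, h s ≠ 0 → 0 < s ∧ s < R := fun s hs =>
    ⟨lt_of_not_ge fun hle => hs (hzero s (Or.inl (hle.trans hr.le))),
      lt_of_not_ge fun hle => hs (hzero s (Or.inr hle))⟩
  have hsupp : Function.support K ⊆ Metric.closedBall (0 : ℝ × ℝ) R := by
    intro q hq
    rw [Function.mem_support] at hq
    have hq' := indicator_apply_ne_zero.1 hq
    have hmem : |q.1| < q.2 := hq'.1
    have hG : q.2 * h q.2 * g (q.1 / q.2) ≠ 0 := hq'.2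
    have hh0 : h q.2 ≠ 0 := fun h0 => hG (by rw [h0, mul_zero, zero_mul])
    obtain ⟨hpos, hlt⟩ := hsR _ hh0
    rw [Metric.mem_closedBall, dist_zero_right, Prod.norm_def, Real.norm_eq_abs, Real.norm_eq_abs]
    exact max_le (by linarith) (by rw [abs_of_pos hpos]; exact hlt.le)
  have hbound : ∀ q, ‖K q‖ ≤ |R| * Ch * Cg := by
    intro q
    refine (norm_indicator_le_norm_self _ _).trans ?_
    rw [norm_mul, norm_mul]
    have h2 : ‖q.2‖ * ‖h q.2‖ ≤ |R| * Ch := by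
      by_cases hq : h q.2 = 0
      · rw [hq, norm_zero, mul_zero]
        exact mul_nonneg (abs_nonneg R) hCh0
      · obtain ⟨hpos, hlt⟩ := hsR _ hq
        have hqR : ‖q.2‖ ≤ |R| := by
          rw [Real.norm_eq_abs, abs_of_pos hpos]
          exact hlt.le.trans (le_abs_self R)
        exact mul_le_mul hqR (hCh _) (norm_nonneg _) (abs_nonneg R)
    exact mul_le_mul h2 (hCg _) (norm_nonneg _) (mul_nonneg (abs_nonneg R) hCh0)
  have hint : IntegrableOn K (Metric.closedBall (0 : ℝ × ℝ) R) (volume.prod volume) :=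
    Measure.integrableOn_of_bounded measure_closedBall_lt_top.ne hKm.aestronglyMeasurable
      (Eventually.of_forall fun q => hbound q)
  exact (integrableOn_iff_integrable_of_support_subset hsupp).1 hint

/-- The integrand `z ↦ h(‖z‖) g(⟪a, z⟫ / ‖z‖)` is integrable on `ℝ³` when `h` and `g` are
continuous and bounded and `h` vanishes on `[R, ∞)` (it is bounded, measurable and supported in
the closed ball of radius `R`). [folklore] -/
theorem landauTail_integrable_radial_mul_angular (a : EuclideanSpace ℝ (Fin 3)) (h g : ℝ → ℝ)
    (hh : Continuous h) (hg : Continuous g) {r R Ch Cg : ℝ}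
    (hzero : ∀ s : ℝ, (s ≤ r ∨ R ≤ s) → h s = 0) (hCh : ∀ s, ‖h s‖ ≤ Ch) (hCg : ∀ c, ‖g c‖ ≤ Cg) :
    Integrable (fun z : EuclideanSpace ℝ (Fin 3) => h ‖z‖ * g (⟪a, z⟫_ℝ / ‖z‖)) := by
  have hm : Measurable fun z : EuclideanSpace ℝ (Fin 3) => h ‖z‖ * g (⟪a, z⟫_ℝ / ‖z‖) :=
    (hh.measurable.comp continuous_norm.measurable).mul
      (hg.measurable.comp
        ((continuous_const.inner continuous_id).measurable.div continuous_norm.measurable))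
  have hsupp : Function.support (fun z : EuclideanSpace ℝ (Fin 3) => h ‖z‖ * g (⟪a, z⟫_ℝ / ‖z‖)) ⊆
      Metric.closedBall 0 R := by
    intro z hz
    rw [Function.mem_support] at hz
    have hh0 : h ‖z‖ ≠ 0 := fun h0 => hz (by rw [h0, zero_mul])
    have hlt : ‖z‖ < R := lt_of_not_ge fun hle => hh0 (hzero _ (Or.inr hle))
    exact mem_closedBall_zero_iff.2 hlt.le
  have hbound : ∀ z : EuclideanSpace ℝ (Fin 3), ‖h ‖z‖ * g (⟪a, z⟫_ℝ / ‖z‖)‖ ≤ Ch * Cg := fun z => by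
    rw [norm_mul]
    exact mul_le_mul (hCh _) (hCg _) (norm_nonneg _) ((norm_nonneg _).trans (hCh 0))
  exact (integrableOn_iff_integrable_of_support_subset hsupp).1
    (Measure.integrableOn_of_bounded measure_closedBall_lt_top.ne hm.aestronglyMeasurable
      (Eventually.of_forall hbound))

/-- **Archimedes' angular reduction, continuous bounded `g`**: for a unit vector `a ∈ ℝ³`,
`h` continuous vanishing off `(r, R)` (`0 < r`) and `g` continuous and bounded on `ℝ`,
`∫_{ℝ³} h(‖z‖) g(⟪a, z⟫ / ‖z‖) dz = 2π (∫₀^∞ h(s) s² ds) (∫_{-1}^{1} g)`. Fubini through the frame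
map `x ↦ (coords a x, ⟪a, x⟫)` (`measurePreserving_coordsInner`), the slices
`landauTail_integral_slice_height` / `landauTail_integral_slice_radius` and one Fubini swap.
(Archimedes, *On the Sphere and Cylinder* I, hat-box theorem) [folklore] -/
theorem landauTail_integral_radial_mul_angular_of_continuous (a : EuclideanSpace ℝ (Fin 3))
    (h g : ℝ → ℝ) (ha : ‖a‖ = 1) (hh : Continuous h) {r R : ℝ} (hr : 0 < r)
    (hzero : ∀ s : ℝ, (s ≤ r ∨ R ≤ s) → h s = 0) (hg : Continuous g) {Cg : ℝ}
    (hCg : ∀ c, ‖g c‖ ≤ Cg) :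
    ∫ z : EuclideanSpace ℝ (Fin 3), h ‖z‖ * g (⟪a, z⟫_ℝ / ‖z‖) =
      2 * Real.pi * (∫ s in Ioi (0 : ℝ), h s * s ^ 2) * ∫ c in (-1 : ℝ)..1, g c := by
  -- a global bound for `h`
  obtain ⟨Ch, hCh⟩ : ∃ C : ℝ, ∀ s, ‖h s‖ ≤ C := by
    obtain ⟨C, hC⟩ :=
      (isCompact_Icc : IsCompact (Icc r R)).exists_bound_of_continuousOn hh.continuousOn
    refine ⟨max C 0, fun s => ?_⟩
    by_cases hs : s ∈ Icc r R
    · exact (hC s hs).trans (le_max_left _ _)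
    · rw [mem_Icc, not_and_or, not_le, not_le] at hs
      rw [hzero s (hs.imp le_of_lt le_of_lt), norm_zero]
      exact le_max_right _ _
  -- the integrand in the frame coordinates `(p, t) = (coords a z, ⟪a, z⟫)` and the swapped kernel
  set F : EuclideanSpace ℝ (Fin 2) × ℝ → ℝ := fun q =>
    h (√(‖q.1‖ ^ 2 + q.2 ^ 2)) * g (q.2 / √(‖q.1‖ ^ 2 + q.2 ^ 2)) with hF
  set K : ℝ × ℝ → ℝ :=
    {q : ℝ × ℝ | |q.1| < q.2}.indicator (fun q => q.2 * h q.2 * g (q.1 / q.2)) with hK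
  have hsm : Measurable fun q : EuclideanSpace ℝ (Fin 2) × ℝ => √(‖q.1‖ ^ 2 + q.2 ^ 2) :=
    (Real.continuous_sqrt.comp
      (((continuous_norm.comp continuous_fst).pow 2).add (continuous_snd.pow 2))).measurable
  have hFm : Measurable F := (hh.measurable.comp hsm).mul (hg.measurable.comp (measurable_snd.div hsm))
  have hnorm : ∀ z : EuclideanSpace ℝ (Fin 3),
      √(‖Literature.Analysis.FluidPDE.Lambert.coords a z‖ ^ 2 + ⟪a, z⟫_ℝ ^ 2) = ‖z‖ := fun z => by
    rw [Literature.Analysis.FluidPDE.Lambert.norm_sq_coords ha, sub_add_cancel,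
      Real.sqrt_sq (norm_nonneg _)]
  have hcomp : (fun z : EuclideanSpace ℝ (Fin 3) => h ‖z‖ * g (⟪a, z⟫_ℝ / ‖z‖)) =
      fun z => F (Literature.Analysis.FluidPDE.Lambert.coords a z, ⟪a, z⟫_ℝ) := by
    funext z
    simp only [hF, hnorm]
  have hφ := Literature.Analysis.FluidPDE.measurePreserving_coordsInner ha
  -- Step 1: transport to `ℝ² × ℝ`
  have h1 : ∫ z : EuclideanSpace ℝ (Fin 3), h ‖z‖ * g (⟪a, z⟫_ℝ / ‖z‖) = ∫ q, F q := by
    rw [hcomp, ← integral_map hφ.measurable.aemeasurable hFm.aestronglyMeasurable, hφ.map_eq]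
  have hFi : Integrable F ((volume : Measure (EuclideanSpace ℝ (Fin 2))).prod (volume : Measure ℝ)) := by
    have h3i := landauTail_integrable_radial_mul_angular a h g hh hg hzero hCh hCg
    rw [hcomp] at h3i
    have hi := (integrable_map_measure hFm.aestronglyMeasurable hφ.measurable.aemeasurable).2 h3i
    rwa [hφ.map_eq] at hi
  -- Step 2: Fubini, the height `t` outside
  have h2 : ∫ q, F q = ∫ t : ℝ, ∫ p : EuclideanSpace ℝ (Fin 2), F (p, t) := integral_prod_symm F hFi
  -- Step 3: the slices at fixed height
  have hKpt : ∀ t s : ℝ, K (t, s) = (Ioi |t|).indicator (fun s => s * h s * g (t / s)) s := by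
    intro t s
    by_cases hts : |t| < s
    · rw [hK, indicator_of_mem (show (t, s) ∈ {q : ℝ × ℝ | |q.1| < q.2} from hts),
        indicator_of_mem (show s ∈ Ioi |t| from hts)]
    · rw [hK, indicator_of_notMem (show (t, s) ∉ {q : ℝ × ℝ | |q.1| < q.2} from hts),
        indicator_of_notMem (show s ∉ Ioi |t| from hts)]
  have h3 : ∀ t : ℝ, ∫ p : EuclideanSpace ℝ (Fin 2), F (p, t) = 2 * Real.pi * ∫ s, K (t, s) := by
    intro t
    simp only [hF, hKpt]
    rw [landauTail_integral_slice_height h g t, integral_indicator measurableSet_Ioi]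
  -- Step 4: swap the `t`- and `s`-integrals
  have hKi : Integrable K ((volume : Measure ℝ).prod (volume : Measure ℝ)) :=
    landauTail_integrable_kernel h g hh hg hr hzero hCh hCg
  have h4 : ∫ t : ℝ, ∫ s : ℝ, K (t, s) = ∫ s : ℝ, ∫ t : ℝ, K (t, s) := integral_integral_swap hKi
  -- Step 5: the slices at fixed radius
  have h5 : ∀ s : ℝ, ∫ t : ℝ, K (t, s) =
      (Ioi (0 : ℝ)).indicator (fun s => h s * s ^ 2 * ∫ c in (-1 : ℝ)..1, g c) s :=
    fun s => landauTail_integral_slice_radius h g s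
  calc ∫ z : EuclideanSpace ℝ (Fin 3), h ‖z‖ * g (⟪a, z⟫_ℝ / ‖z‖) = ∫ q, F q := h1
    _ = ∫ t : ℝ, ∫ p : EuclideanSpace ℝ (Fin 2), F (p, t) := h2
    _ = ∫ t : ℝ, 2 * Real.pi * ∫ s, K (t, s) := integral_congr_ae (Eventually.of_forall h3)
    _ = 2 * Real.pi * ∫ s : ℝ, ∫ t : ℝ, K (t, s) := by rw [integral_const_mul, h4]
    _ = 2 * Real.pi * ∫ s in Ioi (0 : ℝ), h s * s ^ 2 * ∫ c in (-1 : ℝ)..1, g c := by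
        simp_rw [h5]
        rw [integral_indicator measurableSet_Ioi]
    _ = 2 * Real.pi * (∫ s in Ioi (0 : ℝ), h s * s ^ 2) * ∫ c in (-1 : ℝ)..1, g c := by
        rw [integral_mul_const]
        ring

/-- **Archimedes' angular reduction (hat-box theorem) for radial × zonal integrands on `ℝ³`**:
for a unit vector `a`, `h` continuous vanishing off an annulus `(r, R)` with `0 < r < R`, and `g`
continuous on `[-1, 1]`,
`∫_{ℝ³} h(‖z‖) g(⟪a, z⟫ / ‖z‖) dz = 2π (∫₀^∞ h(s) s² ds) (∫_{-1}^{1} g(c) dc)`; equivalently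
`∫_{S²} g(⟪a, α⟫) dσ(α) = 2π ∫_{-1}^{1} g`. Reduced to the continuous bounded case
`landauTail_integral_radial_mul_angular_of_continuous` by clamping the argument of `g` to
`[-1, 1]` (Cauchy–Schwarz: `|⟪a, z⟫| / ‖z‖ ≤ 1`). (Archimedes, *On the Sphere and Cylinder* I)
[folklore] -/
theorem landauTail_integral_radial_mul_angular : ∀ (a : EuclideanSpace ℝ (Fin 3)) (h g : ℝ → ℝ), ‖a‖ = 1 → Continuous h → (∃ r R : ℝ, 0 < r ∧ r < R ∧ ∀ s : ℝ, (s ≤ r ∨ R ≤ s) → h s = 0) → ContinuousOn g (Set.Icc (-1 : ℝ) 1) → ∫ z : EuclideanSpace ℝ (Fin 3), h ‖z‖ * g (inner ℝ a z / ‖z‖) = 2 * Real.pi * (∫ s in Set.Ioi (0 : ℝ), h s * s ^ 2) * ∫ c in (-1 : ℝ)..1, g c := by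
  intro a h g ha hh hsupp hg
  obtain ⟨r, R, hr, -, hzero⟩ := hsupp
  -- clamp the argument of `g` to `[-1, 1]`
  have hclamp : ∀ c : ℝ, max (-1) (min c 1) ∈ Icc (-1 : ℝ) 1 := fun c =>
    ⟨le_max_left _ _, max_le (by norm_num) (min_le_right _ _)⟩
  have hgc : Continuous fun c : ℝ => g (max (-1) (min c 1)) :=
    hg.comp_continuous (continuous_const.max (continuous_id.min continuous_const)) hclamp
  have hgc_eq : ∀ c ∈ Icc (-1 : ℝ) 1, g (max (-1) (min c 1)) = g c := fun c hc => by
    rw [min_eq_left hc.2, max_eq_right hc.1]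
  obtain ⟨Cg, hCg⟩ := (isCompact_Icc : IsCompact (Icc (-1 : ℝ) 1)).exists_bound_of_continuousOn hg
  have hCgc : ∀ c : ℝ, ‖g (max (-1) (min c 1))‖ ≤ Cg := fun c => hCg _ (hclamp c)
  have hL : ∫ z : EuclideanSpace ℝ (Fin 3), h ‖z‖ * g (⟪a, z⟫_ℝ / ‖z‖) =
      ∫ z : EuclideanSpace ℝ (Fin 3), h ‖z‖ * g (max (-1) (min (⟪a, z⟫_ℝ / ‖z‖) 1)) := by
    refine integral_congr_ae (Eventually.of_forall fun z => ?_)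
    have hcs := abs_real_inner_div_norm_mul_norm_le_one a z
    rw [ha, one_mul] at hcs
    beta_reduce
    rw [hgc_eq _ (abs_le.1 hcs)]
  have hRHS : ∫ c in (-1 : ℝ)..1, g c = ∫ c in (-1 : ℝ)..1, g (max (-1) (min c 1)) :=
    intervalIntegral.integral_congr fun c hc =>
      (hgc_eq c (by rwa [uIcc_of_le (by norm_num : (-1 : ℝ) ≤ 1)] at hc)).symm
  rw [hL, hRHS]
  exact landauTail_integral_radial_mul_angular_of_continuous a h (fun c => g (max (-1) (min c 1)))
    ha hh hr hzero hgc hCgc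

end Summit.NavierStokesRegularity.NavierStokesRegularity.Theorems
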